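import Mathlib.Data.Sum.Order
import Mathlib.Logic.Equiv.Fin.Basic
import Literature.MathematicalPhysics.QuantumFieldTheory.Dimock2011to13.QED3AntisymmetricKernels
import Literature.MathematicalPhysics.QuantumFieldTheory.Dimock2011to13.QED3FermionPartialIntegral
import HarnessLib

/-!
# Dimock, *Quantum electrodynamics on the 3-torus I*, Appendix B (305)–(307): the two-species form
# `F(Ψ,Ψ̄) = Σ_{n,m} (1/(n!m!)) Σ f_{n,m}(x₁…x_n, x̄₁…x̄_m) Ψ(x₁)⋯Ψ(x_n)Ψ̄(x̄₁)⋯Ψ̄(x̄_m)` with separately antisymmetric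
# kernels `f_{n,m} = f_{n+m}((0,x),(1,x̄))`, its uniqueness, and `‖F‖_h = Σ_{n,m} (h^{n+m}/(n!m!)) ‖f_{n,m}‖₁` — PROVED

statement-level skeleton of published theorems with citation tags; proofs where landed; nothing here is a claim about the Yang–Mills mass gap

**Citation header (reproduction of PUBLISHED work).** J. Dimock, *Quantum electrodynamics on the 3-torus. I. First
step*, arXiv:math-ph/0210020 (2002) [Dimock2002QED3TorusI], **Appendix B** (305)–(307), p.63 L3–34 of the arXiv-v1 text
layer `paper:arxiv-math-ph_0210020`. Writer seat p11 (literature-prover-lit-balaban-p11-g15-0), YM LIT SWEEP item (c)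
D12; fifth file of the App. B cluster (`QED3FermionNorm.lean` (299)–(304), `QED3GaussianIntegralBound.lean` (309)–(313),
`QED3FermionPartialIntegral.lean` (314)–(319), `QED3AntisymmetricKernels.lean` (298)–(299)).

**The printed text (p.63 L3–34).** *"Now we distinguish between `Ψ(x), Ψ̄(x)`. We use a notation in which the spinor
indices are suppressed, i.e. `x_i` really means the pair `(x_i, α_i)`. The general element (298) can then be uniquely
written in the form `F(Ψ,Ψ̄) = Σ_{n,m} (1/(n!m!)) Σ_{x₁…x_n, x̄₁…x̄_m} f_{n,m}(x₁,…,x_n,x̄₁,…,x̄_m) Ψ(x₁)⋯Ψ(x_n)Ψ̄(x̄₁)⋯Ψ̄(x̄_m)`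
(305) where the coefficients `f_{n,m}` are antisymmetric separately in `X_n = (x₁,…,x_n)` and `X̄_m = (x̄₁,…,x̄_m)`. We
have in fact `f_{n,m}(x₁,…,x_n,x̄₁,…,x̄_m) = f_{n+m}((0,x₁),…,(0,x_n),(1,x̄₁),…,(1,x̄_m))` (306). … Now the norm (299) can
be written `‖F‖_h = Σ_{n,m} (h^{n+m}/(n!m!)) ‖f_{n,m}‖₁` (307)."*

**Lean rendering.** The letters `(0,x)` and `(1,x̄)` of (306), ordered with every `Ψ`-letter before every `Ψ̄`-letter,
are the lexicographic sum `ι₁ ⊕ₗ ι₂` of the two index types (`ι₁ = ι₂ =` sites × spinor indices in the paper; kept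
apart here at no cost) — the same two-block bookkeeping `fstPart ∕ sndPart ∕ inlEmb ∕ inrEmb ∕ mapFst ∕ mapSnd` as in
`QED3FermionPartialIntegral.lean` (there the blocks were unprimed ∕ primed fields; here they are `Ψ` ∕ `Ψ̄`).
* `pairTuple x x̄ : Fin (n+m) → ι₁ ⊕ₗ ι₂` — the argument list `((0,x₁),…,(0,x_n),(1,x̄₁),…,(1,x̄_m))` of (306)
  (`pairTuple_eq_append`; `genProd_pairTuple`: `Ψ(pairTuple x x̄) = Ψ(x₁)⋯Ψ(x_n)·Ψ̄(x̄₁)⋯Ψ̄(x̄_m) = mapFst Ψ(X_n) · mapSnd Ψ̄(X̄_m)`);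
* **`kernel₂ F n m x x̄ := kernel F (n+m) (pairTuple x x̄)`** — (306) as the DEFINITION of `f_{n,m}` from the `f_r` of
  (298) (`QED3AntisymmetricKernels.kernel`);
* **`kernel₂_comp_perm`** (*"antisymmetric separately"*): `f_{n,m}(x∘σ, x̄∘τ) = sgn σ · sgn τ · f_{n,m}(x, x̄)` — the
  block permutation `appendPerm σ τ` of `Fin (n+m)` has sign `sgn σ · sgn τ` (`sign_appendPerm`);
* **`expansion_305`** — `F = Σ_{n ≤ |ι₁|} Σ_{m ≤ |ι₂|} (n!)⁻¹(m!)⁻¹ Σ_{x,x̄} f_{n,m}(x,x̄) Ψ(x)Ψ̄(x̄)`, through the fibre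
  sum `sum_kernel₂_smul_genProd` (`Σ_{x,x̄} f_{n,m}(x,x̄)Ψ(x)Ψ̄(x̄) = n!m!·Σ_{S of type (n,m)} c_S θ_S`: a set of generators
  with `n` letters `Ψ` and `m` letters `Ψ̄` is enumerated by exactly `n!·m!` block-ordered injective tuples,
  `card_injective_pairs_eq`), and `sum_ofType` (summing over the types `(n,m)` is summing over all `S`);
* **`kernel₂_unique`** (*"uniquely written"*): any separately antisymmetric family `g_{n,m}` reproducing `F` through
  (305) IS `kernel₂ F` (on the `n!m!` block orderings of a set of generators `g(x,x̄)Ψ(x)Ψ̄(x̄)` is constant,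
  `antisymm₂_smul_genProd_eq`; basis coefficients are unique; antisymmetric functions vanish on repeated letters,
  `eq_zero_of_antisymm_of_not_injective` of `QED3AntisymmetricKernels.lean`);
* **`hNorm_eq_307`** — `‖F‖_h = Σ_{n ≤ |ι₁|} Σ_{m ≤ |ι₂|} (h^{n+m}/(n!m!)) ‖f_{n,m}‖₁`, `‖f_{n,m}‖₁ = Σ_{x,x̄}|f_{n,m}(x,x̄)|`
  (`sum_norm_kernel₂`), where `‖F‖_h` is the tree's `hNorm h F` of `QED3FermionNorm.lean` (= (299), `hNorm_eq_299`).
Degrees `n > |ι₁|` or `m > |ι₂|` carry no injective tuples, so the printed sums over all `n, m` reduce to these ranges.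
The remark *"We usually consider elements in which only terms with `n = m` contribute"* (p.63 L28) is a usage note, not a
statement; the selection rule behind it is the tree's `gaussExpect_genProd_eq_zero_of_charge`. No named facts, no `sorry`.

(v1.1) **(308)–(309) and (312) on the two-species algebra** (p.63 L35–46, p.64 L7–18): for a covariance matrix `C` on the
letters pairing `Ψ` with `Ψ̄` only (`IsChargedCov C`; `∫·dμ_Γ :=` the tree's `gaussExpect 𝕜 C`, as in
`QED3GaussianIntegralBound.lean`) and `Γ(x,x̄) := ∫Ψ(x)Ψ̄(x̄)dμ_Γ` (`twoPoint`, `gaussExpect_gen_mul_gen`):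
**`gaussExpect_pairedProd`** — (309) verbatim, `∫ Ψ(x₁)Ψ̄(x̄₁)⋯Ψ(x_n)Ψ̄(x̄_n) dμ_Γ = det{Γ(x_i,x̄_j)}` (the tree's
`gaussExpect_genPairProd`); **`gaussExpect_genProd_pairTuple_eq_zero`** — *"Terms with `n ≠ m` give zero"*;
`gaussExpect_genProd_pairTuple_eq_det` — the block-ordered `n = m` terms carry the sign `σ_n = (−1)^{n(n−1)/2}` of p.64
L7–8; **`gaussExpect_eq_312`** — (312): `∫F dμ_Γ = Σ_n (σ_n/(n!)²) Σ_{x,x̄} f_{n,n}(x,x̄) det{Γ(x_i,x̄_j)}`.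
-/

noncomputable section

open Finset

namespace Literature.MathematicalPhysics.QuantumFieldTheory.Dimock2011to13

namespace QED3TorusI

open Literature.MathematicalPhysics.QuantumLattice
open Literature.MathematicalPhysics.QuantumLattice.GrassmannAlgebra

variable {𝕜 : Type*} [RCLike 𝕜]
variable {ι₁ ι₂ : Type*} [LinearOrder ι₁] [Fintype ι₁] [LinearOrder ι₂] [Fintype ι₂]

/-! ## The block-ordered argument lists `((0,x₁),…,(0,x_n),(1,x̄₁),…,(1,x̄_m))` of (306) -/

/-- **The argument list of (306)**: `pairTuple x x̄ = ((0,x₁),…,(0,x_n),(1,x̄₁),…,(1,x̄_m))`, a tuple of `n + m` letters of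
`ι₁ ⊕ₗ ι₂` (all `Ψ`-letters `(0,·)` first, then all `Ψ̄`-letters `(1,·)`). [cite: Dimock2002QED3TorusI, App. B (306) p.63 L26–27] -/
def pairTuple {n m : ℕ} (x : Fin n → ι₁) (y : Fin m → ι₂) : Fin (n + m) → ι₁ ⊕ₗ ι₂ :=
  fun k => toLex (Sum.map x y (finSumFinEquiv.symm k))

omit [LinearOrder ι₁] [Fintype ι₁] [LinearOrder ι₂] [Fintype ι₂] in
/-- The first `n` entries are the `Ψ`-letters `(0,x_i)`. [cite: Dimock2002QED3TorusI, App. B (306) p.63 L26–27] -/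
@[simp] theorem pairTuple_castAdd {n m : ℕ} (x : Fin n → ι₁) (y : Fin m → ι₂) (i : Fin n) :
    pairTuple x y (Fin.castAdd m i) = toLex (Sum.inl (x i)) := by
  simp [pairTuple, finSumFinEquiv_symm_apply_castAdd]

omit [LinearOrder ι₁] [Fintype ι₁] [LinearOrder ι₂] [Fintype ι₂] in
/-- The last `m` entries are the `Ψ̄`-letters `(1,x̄_j)`. [cite: Dimock2002QED3TorusI, App. B (306) p.63 L26–27] -/
@[simp] theorem pairTuple_natAdd {n m : ℕ} (x : Fin n → ι₁) (y : Fin m → ι₂) (j : Fin m) :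
    pairTuple x y (Fin.natAdd n j) = toLex (Sum.inr (y j)) := by
  simp [pairTuple, finSumFinEquiv_symm_apply_natAdd]

omit [LinearOrder ι₁] [Fintype ι₁] [LinearOrder ι₂] [Fintype ι₂] in
/-- `pairTuple x x̄` is the concatenation `(0,x) ⧺ (1,x̄)`. [cite: Dimock2002QED3TorusI, App. B (306) p.63 L26–27] -/
theorem pairTuple_eq_append {n m : ℕ} (x : Fin n → ι₁) (y : Fin m → ι₂) :
    pairTuple x y = Fin.append (fun i => toLex (Sum.inl (x i))) (fun j => toLex (Sum.inr (y j))) := by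
  funext k
  refine Fin.addCases (fun i => ?_) (fun j => ?_) k
  · rw [pairTuple_castAdd, Fin.append_left]
  · rw [pairTuple_natAdd, Fin.append_right]

omit [LinearOrder ι₁] [Fintype ι₁] [LinearOrder ι₂] [Fintype ι₂] in
/-- The letters of `pairTuple x x̄` are distinct iff the `x_i` are distinct and the `x̄_j` are distinct. [cite: Dimock2002QED3TorusI, App. B (306) p.63 L26–27] -/
theorem pairTuple_injective_iff {n m : ℕ} {x : Fin n → ι₁} {y : Fin m → ι₂} :
    Function.Injective (pairTuple x y) ↔ Function.Injective x ∧ Function.Injective y := by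
  rw [show pairTuple x y = (toLex ∘ Sum.map x y) ∘ finSumFinEquiv.symm from rfl, Equiv.injective_comp,
    toLex.injective.of_comp_iff, Sum.map_injective]

/-! ## Separate antisymmetry: block permutations -/

/-- The block permutation `σ ⊕ τ` of `Fin (n + m)` permuting the `Ψ`-slots by `σ` and the `Ψ̄`-slots by `τ`. [folklore] -/
def appendPerm {n m : ℕ} (σ : Equiv.Perm (Fin n)) (τ : Equiv.Perm (Fin m)) : Equiv.Perm (Fin (n + m)) :=
  finSumFinEquiv.permCongr (σ.sumCongr τ)

/-- `sgn(σ ⊕ τ) = sgn σ · sgn τ`. [folklore] -/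
private theorem sign_appendPerm {n m : ℕ} (σ : Equiv.Perm (Fin n)) (τ : Equiv.Perm (Fin m)) :
    Equiv.Perm.sign (appendPerm σ τ) = Equiv.Perm.sign σ * Equiv.Perm.sign τ := by
  rw [appendPerm, Equiv.Perm.sign_permCongr, Equiv.Perm.sign_sumCongr]

omit [LinearOrder ι₁] [Fintype ι₁] [LinearOrder ι₂] [Fintype ι₂] in
/-- Permuting `x` by `σ` and `x̄` by `τ` permutes the argument list of (306) by the block permutation `σ ⊕ τ`. [cite: Dimock2002QED3TorusI, App. B (305) p.63 L25–26 («antisymmetric separately in X_n and X̄_m»)] -/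
theorem pairTuple_comp_appendPerm {n m : ℕ} (x : Fin n → ι₁) (y : Fin m → ι₂) (σ : Equiv.Perm (Fin n))
    (τ : Equiv.Perm (Fin m)) : pairTuple (x ∘ σ) (y ∘ τ) = pairTuple x y ∘ appendPerm σ τ := by
  funext k
  simp only [pairTuple, appendPerm, Function.comp_apply, Equiv.permCongr_apply, Equiv.symm_apply_apply,
    Equiv.Perm.sumCongr_apply, Sum.map_map]


/-! ## Letters and monomials of the block-ordered tuples -/

omit [Fintype ι₁] [Fintype ι₂] in
/-- Unfolding. [folklore] -/
private theorem inlEmb_coe (a : ι₁) : (inlEmb : ι₁ ↪o ι₁ ⊕ₗ ι₂) a = toLex (Sum.inl a) := rfl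

omit [Fintype ι₁] [Fintype ι₂] in
/-- Unfolding. [folklore] -/
private theorem inrEmb_coe (b : ι₂) : (inrEmb : ι₂ ↪o ι₁ ⊕ₗ ι₂) b = toLex (Sum.inr b) := rfl

omit [Fintype ι₁] [Fintype ι₂] in
/-- The letters of `pairTuple x x̄`: the `Ψ`-block is the set of the `x_i`, the `Ψ̄`-block the set of the `x̄_j`. [cite: Dimock2002QED3TorusI, App. B (306) p.63 L26–27] -/
theorem letters_pairTuple {n m : ℕ} (x : Fin n → ι₁) (y : Fin m → ι₂) :
    univ.image (pairTuple x y) =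
      (univ.image x).map (inlEmb : ι₁ ↪o ι₁ ⊕ₗ ι₂).toEmbedding ∪
        (univ.image y).map (inrEmb : ι₂ ↪o ι₁ ⊕ₗ ι₂).toEmbedding := by
  ext w
  simp only [mem_union, mem_map, mem_image, mem_univ, true_and, RelEmbedding.coe_toEmbedding, inlEmb_coe, inrEmb_coe]
  constructor
  · rintro ⟨k, rfl⟩
    obtain ⟨s, rfl⟩ := finSumFinEquiv.surjective k
    rcases s with i | j
    · exact Or.inl ⟨x i, ⟨i, rfl⟩, by rw [finSumFinEquiv_apply_left, pairTuple_castAdd]⟩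
    · exact Or.inr ⟨y j, ⟨j, rfl⟩, by rw [finSumFinEquiv_apply_right, pairTuple_natAdd]⟩
  · rintro (⟨a, ⟨i, rfl⟩, rfl⟩ | ⟨b, ⟨j, rfl⟩, rfl⟩)
    · exact ⟨Fin.castAdd m i, pairTuple_castAdd x y i⟩
    · exact ⟨Fin.natAdd n j, pairTuple_natAdd x y j⟩

omit [Fintype ι₁] [Fintype ι₂] in
/-- The embedding of a sub-block maps ordered products to ordered products, `Ψ(ξ₁)⋯Ψ(ξ_r) ↦ Ψ(f ξ₁)⋯Ψ(f ξ_r)`. [folklore] -/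
private theorem map_genProd {κ J : Type*} [LinearOrder κ] [Fintype κ] [LinearOrder J] (f : κ ↪o J) :
    ∀ {r : ℕ} (ξ : Fin r → κ),
      ExteriorAlgebra.map (Function.ExtendByZero.linearMap 𝕜 f) (genProd 𝕜 ξ) = genProd 𝕜 (f ∘ ξ)
  | 0, ξ => by rw [genProd_zero, genProd_zero, map_one]
  | r + 1, ξ => by
    rw [genProd_succ, map_mul, map_extendByZero_gen, map_genProd f (Fin.tail ξ), genProd_succ]
    rfl

/-- **`Ψ(pairTuple x x̄) = Ψ(x₁)⋯Ψ(x_n) Ψ̄(x̄₁)⋯Ψ̄(x̄_m) = Ψ(X_n)Ψ̄(X̄_m)`** — the monomials of (305). [cite: Dimock2002QED3TorusI, App. B (305)–(306) p.63 L3–27] -/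
theorem genProd_pairTuple {n m : ℕ} (x : Fin n → ι₁) (y : Fin m → ι₂) :
    genProd 𝕜 (pairTuple x y) = mapFst (𝕜 := 𝕜) (genProd 𝕜 x) * mapSnd (genProd 𝕜 y) := by
  rw [pairTuple_eq_append, genProd_append, mapFst, mapSnd, map_genProd, map_genProd]
  rfl

/-! ## (306): the kernels `f_{n,m}` and their separate antisymmetry -/

/-- **The kernels `f_{n,m}` of (305), defined by (306)**: `f_{n,m}(x₁,…,x_n,x̄₁,…,x̄_m) = f_{n+m}((0,x₁),…,(0,x_n),(1,x̄₁),…,(1,x̄_m))`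
with `f_r = kernel F r` the totally antisymmetric kernels of (298). [cite: Dimock2002QED3TorusI, App. B (306) p.63 L26–27] -/
def kernel₂ (F : GrassmannAlgebra 𝕜 (ι₁ ⊕ₗ ι₂)) (n m : ℕ) (x : Fin n → ι₁) (y : Fin m → ι₂) : 𝕜 :=
  kernel F (n + m) (pairTuple x y)

/-- **`f_{n,m}` is antisymmetric separately in `X_n` and `X̄_m`**: `f_{n,m}(x∘σ, x̄∘τ) = sgn σ · sgn τ · f_{n,m}(x, x̄)`. [cite: Dimock2002QED3TorusI, App. B (305) p.63 L25–26 («antisymmetric separately in X_n and X̄_m»)] -/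
theorem kernel₂_comp_perm (F : GrassmannAlgebra 𝕜 (ι₁ ⊕ₗ ι₂)) {n m : ℕ} (x : Fin n → ι₁) (y : Fin m → ι₂)
    (σ : Equiv.Perm (Fin n)) (τ : Equiv.Perm (Fin m)) :
    kernel₂ F n m (x ∘ σ) (y ∘ τ) =
      ((Equiv.Perm.sign σ : ℤ) : 𝕜) * ((Equiv.Perm.sign τ : ℤ) : 𝕜) * kernel₂ F n m x y := by
  rw [kernel₂, pairTuple_comp_appendPerm, kernel_comp_perm, sign_appendPerm, Units.val_mul, Int.cast_mul, kernel₂]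

/-- Antisymmetry in `X_n = (x₁,…,x_n)` alone: `f_{n,m}(x∘σ, x̄) = sgn σ · f_{n,m}(x, x̄)`. [cite: Dimock2002QED3TorusI, App. B (305) p.63 L25–26 («antisymmetric separately in X_n and X̄_m»)] -/
theorem kernel₂_comp_perm_left (F : GrassmannAlgebra 𝕜 (ι₁ ⊕ₗ ι₂)) {n m : ℕ} (x : Fin n → ι₁) (y : Fin m → ι₂)
    (σ : Equiv.Perm (Fin n)) :
    kernel₂ F n m (x ∘ σ) y = ((Equiv.Perm.sign σ : ℤ) : 𝕜) * kernel₂ F n m x y := by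
  have h := kernel₂_comp_perm F x y σ 1
  rwa [Equiv.Perm.sign_one, Units.val_one, Int.cast_one, mul_one] at h

/-- Antisymmetry in `X̄_m = (x̄₁,…,x̄_m)` alone: `f_{n,m}(x, x̄∘τ) = sgn τ · f_{n,m}(x, x̄)`. [cite: Dimock2002QED3TorusI, App. B (305) p.63 L25–26 («antisymmetric separately in X_n and X̄_m»)] -/
theorem kernel₂_comp_perm_right (F : GrassmannAlgebra 𝕜 (ι₁ ⊕ₗ ι₂)) {n m : ℕ} (x : Fin n → ι₁) (y : Fin m → ι₂)
    (τ : Equiv.Perm (Fin m)) :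
    kernel₂ F n m x (y ∘ τ) = ((Equiv.Perm.sign τ : ℤ) : 𝕜) * kernel₂ F n m x y := by
  have h := kernel₂_comp_perm F x y 1 τ
  rwa [Equiv.Perm.sign_one, Units.val_one, Int.cast_one, one_mul] at h

/-- `f_{n,m}` vanishes when a letter repeats in `X_n` or in `X̄_m`. [cite: Dimock2002QED3TorusI, App. B (305) p.63 L25–26 («antisymmetric separately in X_n and X̄_m»)] -/
theorem kernel₂_of_not_injective (F : GrassmannAlgebra 𝕜 (ι₁ ⊕ₗ ι₂)) {n m : ℕ} {x : Fin n → ι₁} {y : Fin m → ι₂}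
    (h : ¬(Function.Injective x ∧ Function.Injective y)) : kernel₂ F n m x y = 0 :=
  kernel_of_not_injective F fun hinj => h (pairTuple_injective_iff.1 hinj)

/-- One term of (305): `f_{n,m}(x,x̄) Ψ(x)Ψ̄(x̄) = c_S θ_S` with `S` the letters, for distinct letters; `0` otherwise. [cite: Dimock2002QED3TorusI, App. B (305)–(306) p.63 L3–27] -/
theorem kernel₂_smul_genProd (F : GrassmannAlgebra 𝕜 (ι₁ ⊕ₗ ι₂)) {n m : ℕ} (x : Fin n → ι₁) (y : Fin m → ι₂) :
    kernel₂ F n m x y • genProd 𝕜 (pairTuple x y) =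
      if Function.Injective (pairTuple x y) then
        coeff F (univ.image (pairTuple x y)) • grassmannBasis 𝕜 (ι₁ ⊕ₗ ι₂) (univ.image (pairTuple x y))
      else 0 :=
  kernel_smul_genProd F (pairTuple x y)

/-! ## Counting: a set of generators of type `(n,m)` has `n!·m!` block orderings -/

/-- **Exactly `n!·m!` pairs of tuples of distinct letters enumerate a set of generators with `n` letters `Ψ` and `m`
letters `Ψ̄`** — the `1/(n!m!)` of (305), (307). [cite: Dimock2002QED3TorusI, App. B (305)–(306) p.63 L3–27] -/
theorem card_injective_pairs_eq (S : Finset (ι₁ ⊕ₗ ι₂)) {n m : ℕ} (hn : (fstPart S).card = n)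
    (hm : (sndPart S).card = m) :
    (univ.filter fun p : (Fin n → ι₁) × (Fin m → ι₂) =>
        Function.Injective (pairTuple p.1 p.2) ∧ univ.image (pairTuple p.1 p.2) = S).card =
      n.factorial * m.factorial := by
  classical
  have hset : (univ.filter fun p : (Fin n → ι₁) × (Fin m → ι₂) =>
        Function.Injective (pairTuple p.1 p.2) ∧ univ.image (pairTuple p.1 p.2) = S) =
      (univ.filter fun x : Fin n → ι₁ => Function.Injective x ∧ univ.image x = fstPart S) ×ˢ
        (univ.filter fun y : Fin m → ι₂ => Function.Injective y ∧ univ.image y = sndPart S) := by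
    ext ⟨x, y⟩
    simp only [mem_filter, mem_univ, true_and, mem_product]
    rw [pairTuple_injective_iff, letters_pairTuple]
    constructor
    · rintro ⟨⟨hx, hy⟩, hS⟩
      refine ⟨⟨hx, ?_⟩, ⟨hy, ?_⟩⟩
      · rw [← hS, fstPart_union]
      · rw [← hS, sndPart_union]
    · rintro ⟨⟨hx, hxS⟩, ⟨hy, hyS⟩⟩
      refine ⟨⟨hx, hy⟩, ?_⟩
      rw [hxS, hyS, map_fstPart_union_map_sndPart]
  rw [hset, card_product, card_injective_range_eq_factorial _ hn, card_injective_range_eq_factorial _ hm]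

/-- The sets of generators of two-species type `(n,m)`: `n` letters `Ψ` and `m` letters `Ψ̄` (the index set of the
`(n,m)` term of (305) in the monomial basis). [cite: Dimock2002QED3TorusI, App. B (305) p.63 L3–24] -/
abbrev ofType (n m : ℕ) : Finset (Finset (ι₁ ⊕ₗ ι₂)) :=
  univ.filter fun S => (fstPart S).card = n ∧ (sndPart S).card = m

/-- **`Σ_{x,x̄} f_{n,m}(x,x̄) Ψ(x₁)⋯Ψ(x_n)Ψ̄(x̄₁)⋯Ψ̄(x̄_m) = n!·m! · Σ_{S of type (n,m)} c_S θ_S`** — the `n!m!` of (305) counts the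
block orderings of each set of generators. [cite: Dimock2002QED3TorusI, App. B (305)–(306) p.63 L3–27] -/
theorem sum_kernel₂_smul_genProd (F : GrassmannAlgebra 𝕜 (ι₁ ⊕ₗ ι₂)) (n m : ℕ) :
    ∑ x : Fin n → ι₁, ∑ y : Fin m → ι₂, kernel₂ F n m x y • genProd 𝕜 (pairTuple x y) =
      ((n.factorial * m.factorial : ℕ) : 𝕜) •
        ∑ S ∈ ofType n m, coeff F S • grassmannBasis 𝕜 (ι₁ ⊕ₗ ι₂) S := by
  classical
  rw [← Finset.sum_product' univ univ (fun x y => kernel₂ F n m x y • genProd 𝕜 (pairTuple x y)), univ_product_univ]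
  simp only [kernel₂_smul_genProd]
  rw [← Finset.sum_fiberwise univ (fun p : (Fin n → ι₁) × (Fin m → ι₂) => univ.image (pairTuple p.1 p.2))
    (fun p => if Function.Injective (pairTuple p.1 p.2) then
      coeff F (univ.image (pairTuple p.1 p.2)) • grassmannBasis 𝕜 (ι₁ ⊕ₗ ι₂) (univ.image (pairTuple p.1 p.2)) else 0)]
  rw [Finset.smul_sum, ← Finset.sum_subset (subset_univ (ofType n m))]
  · refine Finset.sum_congr rfl fun S hS => ?_
    obtain ⟨hn, hm⟩ := (mem_filter.1 hS).2
    rw [← Finset.sum_filter_add_sum_filter_not _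
      (fun p : (Fin n → ι₁) × (Fin m → ι₂) => Function.Injective (pairTuple p.1 p.2))]
    have hz : ∑ p ∈ (univ.filter fun p : (Fin n → ι₁) × (Fin m → ι₂) => univ.image (pairTuple p.1 p.2) = S).filter
        (fun p => ¬Function.Injective (pairTuple p.1 p.2)),
        (if Function.Injective (pairTuple p.1 p.2) then
          coeff F (univ.image (pairTuple p.1 p.2)) • grassmannBasis 𝕜 (ι₁ ⊕ₗ ι₂) (univ.image (pairTuple p.1 p.2))
        else 0) = 0 :=
      Finset.sum_eq_zero fun p hp => by rw [if_neg (mem_filter.1 hp).2]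
    rw [hz, add_zero, Finset.filter_filter]
    have hconst : ∀ p ∈ univ.filter (fun p : (Fin n → ι₁) × (Fin m → ι₂) =>
        univ.image (pairTuple p.1 p.2) = S ∧ Function.Injective (pairTuple p.1 p.2)),
        (if Function.Injective (pairTuple p.1 p.2) then
          coeff F (univ.image (pairTuple p.1 p.2)) • grassmannBasis 𝕜 (ι₁ ⊕ₗ ι₂) (univ.image (pairTuple p.1 p.2))
        else 0) = coeff F S • grassmannBasis 𝕜 (ι₁ ⊕ₗ ι₂) S := by
      intro p hp
      obtain ⟨h1, h2⟩ := (mem_filter.1 hp).2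
      rw [if_pos h2, h1]
    rw [Finset.sum_congr rfl hconst, Finset.sum_const, ← Nat.cast_smul_eq_nsmul 𝕜]
    congr 1
    rw [show (univ.filter fun p : (Fin n → ι₁) × (Fin m → ι₂) =>
          univ.image (pairTuple p.1 p.2) = S ∧ Function.Injective (pairTuple p.1 p.2)) =
        univ.filter (fun p : (Fin n → ι₁) × (Fin m → ι₂) =>
          Function.Injective (pairTuple p.1 p.2) ∧ univ.image (pairTuple p.1 p.2) = S) from
      Finset.filter_congr fun p _ => and_comm, card_injective_pairs_eq S hn hm]
  · intro S _ hS
    refine Finset.sum_eq_zero fun p hp => ?_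
    split_ifs with hinj
    · exfalso
      refine hS (mem_filter.2 ⟨mem_univ _, ?_⟩)
      obtain ⟨hx, hy⟩ := pairTuple_injective_iff.1 hinj
      rw [← (mem_filter.1 hp).2, letters_pairTuple, fstPart_union, sndPart_union, card_letters_of_injective hx,
        card_letters_of_injective hy]
      exact ⟨rfl, rfl⟩
    · rfl

/-- Summing over the two-species types `(n,m)`, `n ≤ |ι₁|`, `m ≤ |ι₂|`, is summing over all sets of generators. [folklore] -/
private theorem sum_ofType {M : Type*} [AddCommMonoid M] (g : Finset (ι₁ ⊕ₗ ι₂) → M) :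
    ∑ n ∈ range (Fintype.card ι₁ + 1), ∑ m ∈ range (Fintype.card ι₂ + 1), ∑ S ∈ ofType n m, g S = ∑ S, g S := by
  classical
  have h1 : ∀ n : ℕ, ∑ m ∈ range (Fintype.card ι₂ + 1), ∑ S ∈ ofType n m, g S =
      ∑ S ∈ univ.filter (fun S : Finset (ι₁ ⊕ₗ ι₂) => (fstPart S).card = n), g S := by
    intro n
    rw [← Finset.sum_fiberwise_of_maps_to (s := univ.filter fun S : Finset (ι₁ ⊕ₗ ι₂) => (fstPart S).card = n)
      (t := range (Fintype.card ι₂ + 1)) (g := fun S => (sndPart S).card)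
      (fun S _ => mem_range.2 (Nat.lt_succ_of_le (card_le_univ _)))]
    refine Finset.sum_congr rfl fun m _ => ?_
    rw [Finset.filter_filter]
  simp only [h1]
  exact Finset.sum_fiberwise_of_maps_to (fun S _ => mem_range.2 (Nat.lt_succ_of_le (card_le_univ _))) _

/-! ## (305) and (307) as theorems -/

/-- **(305)**: `F = Σ_{n=0}^{|ι₁|} Σ_{m=0}^{|ι₂|} (1/(n!m!)) Σ_{x₁…x_n} Σ_{x̄₁…x̄_m} f_{n,m}(x₁,…,x_n,x̄₁,…,x̄_m) Ψ(x₁)⋯Ψ(x_n)Ψ̄(x̄₁)⋯Ψ̄(x̄_m)`.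
[cite: Dimock2002QED3TorusI, App. B (305)–(306) p.63 L3–27] -/
theorem expansion_305 (F : GrassmannAlgebra 𝕜 (ι₁ ⊕ₗ ι₂)) :
    F = ∑ n ∈ range (Fintype.card ι₁ + 1), ∑ m ∈ range (Fintype.card ι₂ + 1),
      (((n.factorial : 𝕜)⁻¹ * ((m.factorial : 𝕜)⁻¹)) •
        ∑ x : Fin n → ι₁, ∑ y : Fin m → ι₂, kernel₂ F n m x y • genProd 𝕜 (pairTuple x y)) := by
  classical
  simp only [sum_kernel₂_smul_genProd, smul_smul]
  have hfac : ∀ n m : ℕ, (n.factorial : 𝕜)⁻¹ * (m.factorial : 𝕜)⁻¹ * ((n.factorial * m.factorial : ℕ) : 𝕜) = 1 := by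
    intro n m
    rw [Nat.cast_mul, mul_mul_mul_comm, inv_mul_cancel₀ (Nat.cast_ne_zero.2 (Nat.factorial_ne_zero n)),
      inv_mul_cancel₀ (Nat.cast_ne_zero.2 (Nat.factorial_ne_zero m)), one_mul]
  simp only [hfac, one_smul]
  rw [sum_ofType]
  exact ((grassmannBasis 𝕜 (ι₁ ⊕ₗ ι₂)).sum_repr F).symm

/-- **`‖f_{n,m}‖₁ = n!·m! · Σ_{S of type (n,m)} |c_S|`.** [cite: Dimock2002QED3TorusI, App. B (307) p.63 L29–34] -/
theorem sum_norm_kernel₂ (F : GrassmannAlgebra 𝕜 (ι₁ ⊕ₗ ι₂)) (n m : ℕ) :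
    ∑ x : Fin n → ι₁, ∑ y : Fin m → ι₂, ‖kernel₂ F n m x y‖ =
      ((n.factorial * m.factorial : ℕ) : ℝ) * ∑ S ∈ ofType n m, ‖coeff F S‖ := by
  classical
  have hk : ∀ (x : Fin n → ι₁) (y : Fin m → ι₂), ‖kernel₂ F n m x y‖ =
      if Function.Injective (pairTuple x y) then ‖coeff F (univ.image (pairTuple x y))‖ else 0 := by
    intro x y
    split_ifs with h
    · rw [kernel₂, kernel, norm_mul, norm_monomialSign_of_injective h, one_mul]
      rfl
    · rw [kernel₂, kernel_of_not_injective F h, norm_zero]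
  simp only [hk]
  rw [← Finset.sum_product' univ univ (fun (x : Fin n → ι₁) (y : Fin m → ι₂) =>
    if Function.Injective (pairTuple x y) then ‖coeff F (univ.image (pairTuple x y))‖ else 0), univ_product_univ]
  rw [← Finset.sum_fiberwise univ (fun p : (Fin n → ι₁) × (Fin m → ι₂) => univ.image (pairTuple p.1 p.2))
    (fun p => if Function.Injective (pairTuple p.1 p.2) then ‖coeff F (univ.image (pairTuple p.1 p.2))‖ else 0)]
  rw [Finset.mul_sum, ← Finset.sum_subset (subset_univ (ofType n m))]
  · refine Finset.sum_congr rfl fun S hS => ?_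
    obtain ⟨hn, hm⟩ := (mem_filter.1 hS).2
    rw [← Finset.sum_filter_add_sum_filter_not _
      (fun p : (Fin n → ι₁) × (Fin m → ι₂) => Function.Injective (pairTuple p.1 p.2))]
    have hz : ∑ p ∈ (univ.filter fun p : (Fin n → ι₁) × (Fin m → ι₂) => univ.image (pairTuple p.1 p.2) = S).filter
        (fun p => ¬Function.Injective (pairTuple p.1 p.2)),
        (if Function.Injective (pairTuple p.1 p.2) then ‖coeff F (univ.image (pairTuple p.1 p.2))‖ else 0) = 0 :=
      Finset.sum_eq_zero fun p hp => by rw [if_neg (mem_filter.1 hp).2]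
    rw [hz, add_zero, Finset.filter_filter]
    have hconst : ∀ p ∈ univ.filter (fun p : (Fin n → ι₁) × (Fin m → ι₂) =>
        univ.image (pairTuple p.1 p.2) = S ∧ Function.Injective (pairTuple p.1 p.2)),
        (if Function.Injective (pairTuple p.1 p.2) then ‖coeff F (univ.image (pairTuple p.1 p.2))‖ else 0) =
          ‖coeff F S‖ := by
      intro p hp
      obtain ⟨h1, h2⟩ := (mem_filter.1 hp).2
      rw [if_pos h2, h1]
    rw [Finset.sum_congr rfl hconst, Finset.sum_const, nsmul_eq_mul]
    congr 1
    rw [show (univ.filter fun p : (Fin n → ι₁) × (Fin m → ι₂) =>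
          univ.image (pairTuple p.1 p.2) = S ∧ Function.Injective (pairTuple p.1 p.2)) =
        univ.filter (fun p : (Fin n → ι₁) × (Fin m → ι₂) =>
          Function.Injective (pairTuple p.1 p.2) ∧ univ.image (pairTuple p.1 p.2) = S) from
      Finset.filter_congr fun p _ => and_comm, card_injective_pairs_eq S hn hm]
  · intro S _ hS
    refine Finset.sum_eq_zero fun p hp => ?_
    split_ifs with hinj
    · exfalso
      refine hS (mem_filter.2 ⟨mem_univ _, ?_⟩)
      obtain ⟨hx, hy⟩ := pairTuple_injective_iff.1 hinj
      rw [← (mem_filter.1 hp).2, letters_pairTuple, fstPart_union, sndPart_union, card_letters_of_injective hx,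
        card_letters_of_injective hy]
      exact ⟨rfl, rfl⟩
    · rfl

/-- **(307)**: `‖F‖_h = Σ_{n=0}^{|ι₁|} Σ_{m=0}^{|ι₂|} (h^{n+m}/(n!m!)) ‖f_{n,m}‖₁` with `‖f_{n,m}‖₁ = Σ_{x,x̄} |f_{n,m}(x,x̄)|` — the printed
two-species norm IS the monomial-basis norm `hNorm h F` (= (299), `hNorm_eq_299`). [cite: Dimock2002QED3TorusI, App. B (307) p.63 L29–34] -/
theorem hNorm_eq_307 (h : ℝ) (F : GrassmannAlgebra 𝕜 (ι₁ ⊕ₗ ι₂)) :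
    hNorm h F = ∑ n ∈ range (Fintype.card ι₁ + 1), ∑ m ∈ range (Fintype.card ι₂ + 1),
      h ^ (n + m) / ((n.factorial : ℝ) * m.factorial) * ∑ x : Fin n → ι₁, ∑ y : Fin m → ι₂, ‖kernel₂ F n m x y‖ := by
  classical
  simp only [sum_norm_kernel₂]
  have hfac : ∀ n m : ℕ, h ^ (n + m) / ((n.factorial : ℝ) * m.factorial) *
      (((n.factorial * m.factorial : ℕ) : ℝ) * ∑ S ∈ ofType n m, ‖coeff F S‖) =
      ∑ S ∈ (ofType n m : Finset (Finset (ι₁ ⊕ₗ ι₂))), h ^ S.card * ‖coeff F S‖ := by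
    intro n m
    rw [← mul_assoc, Nat.cast_mul, div_mul_cancel₀ _ (mul_ne_zero (Nat.cast_ne_zero.2 (Nat.factorial_ne_zero n))
      (Nat.cast_ne_zero.2 (Nat.factorial_ne_zero m))), Finset.mul_sum]
    refine Finset.sum_congr rfl fun S hS => ?_
    obtain ⟨hn, hm⟩ := (mem_filter.1 hS).2
    rw [← card_fstPart_add_card_sndPart S, hn, hm]
  simp only [hfac]
  rw [sum_ofType]
  rfl


/-! ## (305), uniqueness -/

omit [RCLike 𝕜] [Fintype ι₁] [Fintype ι₂] in
/-- Changing the indexing data of an evaluation at increasing enumerations along equalities of sets. [folklore] -/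
private theorem eval_congr {β : Type*} (g : (n m : ℕ) → (Fin n → ι₁) → (Fin m → ι₂) → β) {n m : ℕ}
    {s s' : Finset ι₁} {t t' : Finset ι₂} (hs : s = s') (ht : t = t') (hn : s.card = n) (hm : t.card = m) :
    g n m (fun i => s.orderEmbOfFin hn i) (fun j => t.orderEmbOfFin hm j) =
      g s'.card t'.card (fun i => s'.orderEmbOfFin rfl i) (fun j => t'.orderEmbOfFin rfl j) := by
  subst hs ht hn hm
  rfl

/-- Sorting a tuple of distinct letters gives the increasing enumeration of its letters. [folklore] -/
private theorem comp_sort_eq_orderEmbOfFin {α : Type*} [LinearOrder α] {k : ℕ} {x : Fin k → α}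
    (hx : Function.Injective x) :
    x ∘ Tuple.sort x = fun i => (univ.image x).orderEmbOfFin (card_letters_of_injective hx) i :=
  Finset.orderEmbOfFin_unique _ (fun i => mem_image_of_mem _ (mem_univ (Tuple.sort x i)))
    ((Tuple.monotone_sort x).strictMono_of_injective (hx.comp (Tuple.sort x).injective))

/-- **On the fibre of a set of generators a separately antisymmetric `g` times `Ψ(X_n)Ψ̄(X̄_m)` is constant**:
`g(x, x̄) Ψ(x₁)⋯Ψ(x_n)Ψ̄(x̄₁)⋯Ψ̄(x̄_m) = g(x_S, x̄_S) θ_S`, with `x_S, x̄_S` the increasing enumerations of the two blocks of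
the letters `S`. [cite: Dimock2002QED3TorusI, App. B (305) p.63 L3–26 («uniquely written … antisymmetric separately»)] -/
theorem antisymm₂_smul_genProd_eq {n m : ℕ} {g : (Fin n → ι₁) → (Fin m → ι₂) → 𝕜}
    (hg₁ : ∀ x y (σ : Equiv.Perm (Fin n)), g (x ∘ σ) y = ((Equiv.Perm.sign σ : ℤ) : 𝕜) * g x y)
    (hg₂ : ∀ x y (τ : Equiv.Perm (Fin m)), g x (y ∘ τ) = ((Equiv.Perm.sign τ : ℤ) : 𝕜) * g x y)
    {x : Fin n → ι₁} {y : Fin m → ι₂} (hx : Function.Injective x) (hy : Function.Injective y) :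
    g x y • genProd 𝕜 (pairTuple x y) =
      g (fun i => (univ.image x).orderEmbOfFin (card_letters_of_injective hx) i)
        (fun j => (univ.image y).orderEmbOfFin (card_letters_of_injective hy) j) •
        grassmannBasis 𝕜 (ι₁ ⊕ₗ ι₂) (univ.image (pairTuple x y)) := by
  classical
  have hs : ∀ u : ℤˣ, ((u : ℤ) : 𝕜) * ((u : ℤ) : 𝕜) = 1 := fun u => by
    rw [← Int.cast_mul, ← Units.val_mul, Int.units_mul_self, Units.val_one, Int.cast_one]
  have hxs : x ∘ Tuple.sort x = fun i => (univ.image x).orderEmbOfFin (card_letters_of_injective hx) i :=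
    comp_sort_eq_orderEmbOfFin hx
  have hys : y ∘ Tuple.sort y = fun j => (univ.image y).orderEmbOfFin (card_letters_of_injective hy) j :=
    comp_sort_eq_orderEmbOfFin hy
  obtain ⟨u, hu⟩ : ∃ u : ℤˣ, u = Equiv.Perm.sign (appendPerm (Tuple.sort x) (Tuple.sort y)) := ⟨_, rfl⟩
  -- (i) the values: `g(x_S, x̄_S) = sgn σ sgn τ g(x, x̄)`
  have h1 : g (x ∘ Tuple.sort x) (y ∘ Tuple.sort y) = ((u : ℤ) : 𝕜) * g x y := by
    rw [hg₂, hg₁, ← mul_assoc, hu, sign_appendPerm, Units.val_mul, Int.cast_mul,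
      mul_comm (((Equiv.Perm.sign (Tuple.sort y) : ℤ) : 𝕜))]
  -- (ii) the monomials: `Ψ(x_S)Ψ̄(x̄_S) = sgn σ sgn τ Ψ(x)Ψ̄(x̄)`
  have h2 : genProd 𝕜 (pairTuple (x ∘ Tuple.sort x) (y ∘ Tuple.sort y)) = ((u : ℤ) : 𝕜) • genProd 𝕜 (pairTuple x y) := by
    rw [pairTuple_comp_appendPerm, genProd_comp_perm, ← hu]
  -- (iii) the sorted pair is the basis monomial of the letters
  have h3 : genProd 𝕜 (pairTuple (x ∘ Tuple.sort x) (y ∘ Tuple.sort y)) =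
      grassmannBasis 𝕜 (ι₁ ⊕ₗ ι₂) (univ.image (pairTuple x y)) := by
    rw [genProd_pairTuple, hxs, hys, ← grassmannBasis_eq_genProd_of_card, ← grassmannBasis_eq_genProd_of_card,
      grassmannBasis_map_union, letters_pairTuple]
  rw [hxs, hys] at h1
  rw [h1, ← h3, h2, smul_smul, mul_assoc, mul_comm (g x y), ← mul_assoc, hs, one_mul]

/-- **(305), uniqueness.** If separately antisymmetric `g_{n,m}` reproduce
`F = Σ_{n ≤ |ι₁|, m ≤ |ι₂|} (1/(n!m!)) Σ_{x,x̄} g_{n,m}(x, x̄) Ψ(x₁)⋯Ψ(x_n)Ψ̄(x̄₁)⋯Ψ̄(x̄_m)`, then `g_{n,m} = f_{n,m}`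
(`= kernel₂ F n m`) — *"the general element (298) can then be uniquely written in the form (305)"*.
[cite: Dimock2002QED3TorusI, App. B (305) p.63 L3–26 («uniquely written»)] -/
theorem kernel₂_unique (F : GrassmannAlgebra 𝕜 (ι₁ ⊕ₗ ι₂)) (g : (n m : ℕ) → (Fin n → ι₁) → (Fin m → ι₂) → 𝕜)
    (hg₁ : ∀ n m (x : Fin n → ι₁) (y : Fin m → ι₂) (σ : Equiv.Perm (Fin n)),
      g n m (x ∘ σ) y = ((Equiv.Perm.sign σ : ℤ) : 𝕜) * g n m x y)
    (hg₂ : ∀ n m (x : Fin n → ι₁) (y : Fin m → ι₂) (τ : Equiv.Perm (Fin m)),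
      g n m x (y ∘ τ) = ((Equiv.Perm.sign τ : ℤ) : 𝕜) * g n m x y)
    (hF : F = ∑ n ∈ range (Fintype.card ι₁ + 1), ∑ m ∈ range (Fintype.card ι₂ + 1),
      (((n.factorial : 𝕜)⁻¹ * ((m.factorial : 𝕜)⁻¹)) •
        ∑ x : Fin n → ι₁, ∑ y : Fin m → ι₂, g n m x y • genProd 𝕜 (pairTuple x y)))
    (n m : ℕ) (x : Fin n → ι₁) (y : Fin m → ι₂) : g n m x y = kernel₂ F n m x y := by
  classical
  -- Step 1: the fibre sums `Σ_{x,x̄} g(x,x̄)Ψ(x)Ψ̄(x̄) = n!m! Σ_{S of type (n,m)} g(x_S, x̄_S) θ_S`.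
  have hfibre : ∀ n m : ℕ, ∑ x : Fin n → ι₁, ∑ y : Fin m → ι₂, g n m x y • genProd 𝕜 (pairTuple x y) =
      ((n.factorial * m.factorial : ℕ) : 𝕜) • ∑ S ∈ (ofType n m : Finset (Finset (ι₁ ⊕ₗ ι₂))),
        g (fstPart S).card (sndPart S).card (fun i => (fstPart S).orderEmbOfFin rfl i)
          (fun j => (sndPart S).orderEmbOfFin rfl j) • grassmannBasis 𝕜 (ι₁ ⊕ₗ ι₂) S := by
    intro n m
    have hterm : ∀ (x : Fin n → ι₁) (y : Fin m → ι₂), g n m x y • genProd 𝕜 (pairTuple x y) =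
        if hp : Function.Injective (pairTuple x y) then
          g n m (fun i => (univ.image x).orderEmbOfFin (card_letters_of_injective (pairTuple_injective_iff.1 hp).1) i)
            (fun j => (univ.image y).orderEmbOfFin (card_letters_of_injective (pairTuple_injective_iff.1 hp).2) j) •
            grassmannBasis 𝕜 (ι₁ ⊕ₗ ι₂) (univ.image (pairTuple x y))
        else 0 := by
      intro x y
      split_ifs with hp
      · exact antisymm₂_smul_genProd_eq (hg₁ n m) (hg₂ n m) (pairTuple_injective_iff.1 hp).1
          (pairTuple_injective_iff.1 hp).2
      · rw [show genProd 𝕜 (pairTuple x y) = 0 from genProd_eq_zero_of_not_injective hp, smul_zero]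
    simp only [hterm]
    rw [← Finset.sum_product' univ univ (fun (x : Fin n → ι₁) (y : Fin m → ι₂) =>
      if hp : Function.Injective (pairTuple x y) then
        g n m (fun i => (univ.image x).orderEmbOfFin (card_letters_of_injective (pairTuple_injective_iff.1 hp).1) i)
          (fun j => (univ.image y).orderEmbOfFin (card_letters_of_injective (pairTuple_injective_iff.1 hp).2) j) •
          grassmannBasis 𝕜 (ι₁ ⊕ₗ ι₂) (univ.image (pairTuple x y))
      else 0), univ_product_univ]
    rw [← Finset.sum_fiberwise univ (fun p : (Fin n → ι₁) × (Fin m → ι₂) => univ.image (pairTuple p.1 p.2))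
      (fun p => if hp : Function.Injective (pairTuple p.1 p.2) then
        g n m (fun i => (univ.image p.1).orderEmbOfFin (card_letters_of_injective (pairTuple_injective_iff.1 hp).1) i)
          (fun j => (univ.image p.2).orderEmbOfFin (card_letters_of_injective (pairTuple_injective_iff.1 hp).2) j) •
          grassmannBasis 𝕜 (ι₁ ⊕ₗ ι₂) (univ.image (pairTuple p.1 p.2))
      else 0)]
    rw [Finset.smul_sum, ← Finset.sum_subset (subset_univ (ofType n m))]
    · refine Finset.sum_congr rfl fun S hS => ?_
      obtain ⟨hn, hm⟩ := (mem_filter.1 hS).2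
      rw [← Finset.sum_filter_add_sum_filter_not _
        (fun p : (Fin n → ι₁) × (Fin m → ι₂) => Function.Injective (pairTuple p.1 p.2))]
      have hz : ∑ p ∈ (univ.filter fun p : (Fin n → ι₁) × (Fin m → ι₂) =>
          univ.image (pairTuple p.1 p.2) = S).filter (fun p => ¬Function.Injective (pairTuple p.1 p.2)),
          (if hp : Function.Injective (pairTuple p.1 p.2) then
            g n m (fun i => (univ.image p.1).orderEmbOfFin
                (card_letters_of_injective (pairTuple_injective_iff.1 hp).1) i)
              (fun j => (univ.image p.2).orderEmbOfFin
                (card_letters_of_injective (pairTuple_injective_iff.1 hp).2) j) •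
              grassmannBasis 𝕜 (ι₁ ⊕ₗ ι₂) (univ.image (pairTuple p.1 p.2))
          else 0) = 0 :=
        Finset.sum_eq_zero fun p hp => by rw [dif_neg (mem_filter.1 hp).2]
      rw [hz, add_zero, Finset.filter_filter]
      have hconst : ∀ p ∈ univ.filter (fun p : (Fin n → ι₁) × (Fin m → ι₂) =>
          univ.image (pairTuple p.1 p.2) = S ∧ Function.Injective (pairTuple p.1 p.2)),
          (if hp : Function.Injective (pairTuple p.1 p.2) then
            g n m (fun i => (univ.image p.1).orderEmbOfFin
                (card_letters_of_injective (pairTuple_injective_iff.1 hp).1) i)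
              (fun j => (univ.image p.2).orderEmbOfFin
                (card_letters_of_injective (pairTuple_injective_iff.1 hp).2) j) •
              grassmannBasis 𝕜 (ι₁ ⊕ₗ ι₂) (univ.image (pairTuple p.1 p.2))
          else 0) =
          g (fstPart S).card (sndPart S).card (fun i => (fstPart S).orderEmbOfFin rfl i)
            (fun j => (sndPart S).orderEmbOfFin rfl j) • grassmannBasis 𝕜 (ι₁ ⊕ₗ ι₂) S := by
        intro p hp
        obtain ⟨h1, h2⟩ := (mem_filter.1 hp).2
        have hfst : univ.image p.1 = fstPart S := by rw [← h1, letters_pairTuple, fstPart_union]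
        have hsnd : univ.image p.2 = sndPart S := by rw [← h1, letters_pairTuple, sndPart_union]
        rw [dif_pos h2, eval_congr g hfst hsnd, h1]
      rw [Finset.sum_congr rfl hconst, Finset.sum_const, ← Nat.cast_smul_eq_nsmul 𝕜]
      congr 1
      rw [show (univ.filter fun p : (Fin n → ι₁) × (Fin m → ι₂) =>
            univ.image (pairTuple p.1 p.2) = S ∧ Function.Injective (pairTuple p.1 p.2)) =
          univ.filter (fun p : (Fin n → ι₁) × (Fin m → ι₂) =>
            Function.Injective (pairTuple p.1 p.2) ∧ univ.image (pairTuple p.1 p.2) = S) from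
        Finset.filter_congr fun p _ => and_comm, card_injective_pairs_eq S hn hm]
    · intro S _ hS
      refine Finset.sum_eq_zero fun p hp => ?_
      split_ifs with hinj
      · exfalso
        refine hS (mem_filter.2 ⟨mem_univ _, ?_⟩)
        obtain ⟨hx, hy⟩ := pairTuple_injective_iff.1 hinj
        rw [← (mem_filter.1 hp).2, letters_pairTuple, fstPart_union, sndPart_union, card_letters_of_injective hx,
          card_letters_of_injective hy]
        exact ⟨rfl, rfl⟩
      · rfl
  -- Step 2: hence `F = Σ_S g(x_S, x̄_S) θ_S`, and basis coefficients are unique.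
  have hcoeff : ∀ S : Finset (ι₁ ⊕ₗ ι₂), coeff F S =
      g (fstPart S).card (sndPart S).card (fun i => (fstPart S).orderEmbOfFin rfl i)
        (fun j => (sndPart S).orderEmbOfFin rfl j) := by
    have hF' : F = ∑ S : Finset (ι₁ ⊕ₗ ι₂),
        g (fstPart S).card (sndPart S).card (fun i => (fstPart S).orderEmbOfFin rfl i)
          (fun j => (sndPart S).orderEmbOfFin rfl j) • grassmannBasis 𝕜 (ι₁ ⊕ₗ ι₂) S := by
      conv_lhs => rw [hF]
      simp only [hfibre, smul_smul]
      have hfac : ∀ n m : ℕ, (n.factorial : 𝕜)⁻¹ * (m.factorial : 𝕜)⁻¹ * ((n.factorial * m.factorial : ℕ) : 𝕜) = 1 := by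
        intro n m
        rw [Nat.cast_mul, mul_mul_mul_comm, inv_mul_cancel₀ (Nat.cast_ne_zero.2 (Nat.factorial_ne_zero n)),
          inv_mul_cancel₀ (Nat.cast_ne_zero.2 (Nat.factorial_ne_zero m)), one_mul]
      simp only [hfac, one_smul]
      rw [sum_ofType]
    intro S
    have h := congrArg (fun v => (grassmannBasis 𝕜 (ι₁ ⊕ₗ ι₂)).repr v S) hF'
    simp only [map_sum, map_smul, Module.Basis.repr_self, Finsupp.coe_finsetSum, Finset.sum_apply,
      Finsupp.smul_apply, smul_eq_mul] at h
    rw [coeff, h, Finset.sum_eq_single S]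
    · rw [Finsupp.single_eq_same, mul_one]
    · intro T _ hTS
      rw [Finsupp.single_eq_of_ne (Ne.symm hTS), mul_zero]
    · intro hS
      exact absurd (mem_univ S) hS
  -- Step 3: read off `g_{n,m}(x, x̄) = monomialSign · c_{letters} = f_{n,m}(x, x̄)`.
  by_cases hp : Function.Injective x ∧ Function.Injective y
  · have hinj : Function.Injective (pairTuple x y) := pairTuple_injective_iff.2 hp
    have key := antisymm₂_smul_genProd_eq (hg₁ n m) (hg₂ n m) hp.1 hp.2
    have hl : letters (pairTuple x y) = univ.image (pairTuple x y) := rfl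
    have hmono : genProd 𝕜 (pairTuple x y) =
        (monomialSign (pairTuple x y) : 𝕜) • grassmannBasis 𝕜 (ι₁ ⊕ₗ ι₂) (univ.image (pairTuple x y)) :=
      genProd_eq_monomialSign_smul (pairTuple x y)
    rw [hmono, smul_smul] at key
    have key' := congrArg (fun v => (grassmannBasis 𝕜 (ι₁ ⊕ₗ ι₂)).repr v (univ.image (pairTuple x y))) key
    simp only [map_smul, Module.Basis.repr_self, Finsupp.smul_apply, Finsupp.single_eq_same, smul_eq_mul,
      mul_one] at key'
    -- `key' : g x x̄ * monomialSign = g(x_S, x̄_S)`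
    have hfst : univ.image x = fstPart (univ.image (pairTuple x y)) := by rw [letters_pairTuple, fstPart_union]
    have hsnd : univ.image y = sndPart (univ.image (pairTuple x y)) := by rw [letters_pairTuple, sndPart_union]
    rw [eval_congr g hfst hsnd, ← hcoeff] at key'
    rw [kernel₂, kernel, hl, ← key', mul_comm (g n m x y), ← mul_assoc, monomialSign_mul_self hinj, one_mul]
  · rw [kernel₂_of_not_injective F hp]
    by_cases hx : Function.Injective x
    · have hy : ¬Function.Injective y := fun hy => hp ⟨hx, hy⟩
      exact eq_zero_of_antisymm_of_not_injective (g := fun y => g n m x y) (fun y τ => hg₂ n m x y τ) hy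
    · exact eq_zero_of_antisymm_of_not_injective (g := fun x => g n m x y) (fun x σ => hg₁ n m x y σ) hx

/-! ## (v1.1) (308)–(309) and (312): the Gaussian integral `∫·dμ_Γ` on the two-species algebra

*"A fermion Gaussian "measure" with non-singular covariance `Γ = D⁻¹` can be defined by `dμ_Γ(Ψ,Ψ̄) =
e^{−(Ψ̄,DΨ)}dΨdΨ̄ / ∫e^{−(Ψ̄,DΨ)}dΨdΨ̄` (308) Then one can consider integrals of the form `∫Fdμ_Γ`. Terms with `n ≠ m` give
zero while terms with `n = m` are integrated by `∫ Ψ(x₁)Ψ̄(x̄₁)⋯Ψ(x_n)Ψ̄(x̄_n) dμ_Γ(Ψ,Ψ̄) = det{Γ(x_i,x̄_j)}` (309) For the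
proof see for example [17] whose conventions we have adopted. This identity can also be used to define `dμ_Γ` when `Γ`
is singular."* (p.63 L35–46). As in `QED3GaussianIntegralBound.lean`, `∫·dμ_Γ` is the tree's `gaussExpect 𝕜 C` for a
covariance matrix `C` on the letters which pairs `Ψ` with `Ψ̄` only (`IsChargedCov`), and `Γ(x,x̄) := ∫Ψ(x)Ψ̄(x̄)dμ_Γ`
(`twoPoint`) — the defining data the paper allows for singular `Γ`. -/

/-- The species of a letter: `false` for `Ψ(x) = (0,x)`, `true` for `Ψ̄(x̄) = (1,x̄)`. [cite: Dimock2002QED3TorusI, App. B (308)–(309) p.63 L35–45] -/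
def species (w : ι₁ ⊕ₗ ι₂) : Bool := (ofLex w).isRight

omit [LinearOrder ι₁] [Fintype ι₁] [LinearOrder ι₂] [Fintype ι₂] in
/-- `Ψ`-letters have species `false`. [cite: Dimock2002QED3TorusI, App. B (308)–(309) p.63 L35–45] -/
@[simp] theorem species_inl (a : ι₁) : species (toLex (Sum.inl a) : ι₁ ⊕ₗ ι₂) = false := rfl

omit [LinearOrder ι₁] [Fintype ι₁] [LinearOrder ι₂] [Fintype ι₂] in
/-- `Ψ̄`-letters have species `true`. [cite: Dimock2002QED3TorusI, App. B (308)–(309) p.63 L35–45] -/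
@[simp] theorem species_inr (b : ι₂) : species (toLex (Sum.inr b) : ι₁ ⊕ₗ ι₂) = true := rfl

/-- **The covariance of `dμ_Γ` pairs `Ψ` with `Ψ̄` only** (`e^{−(Ψ̄,DΨ)}`, (308)): as a matrix on the letters it vanishes between
letters of the same species. [cite: Dimock2002QED3TorusI, App. B (308)–(309) p.63 L35–45] -/
def IsChargedCov (C : Matrix (ι₁ ⊕ₗ ι₂) (ι₁ ⊕ₗ ι₂) 𝕜) : Prop := ∀ X Y, species X = species Y → C X Y = 0

/-- **`Γ(x,x̄) = ∫ Ψ(x)Ψ̄(x̄) dμ_Γ`**, the two-point function of (309) (the tree's `contr 𝕜 C` between the letters `(0,x)` and `(1,x̄)`;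
`gaussExpect_gen_mul_gen`). [cite: Dimock2002QED3TorusI, App. B (308)–(309) p.63 L35–45] -/
def twoPoint (C : Matrix (ι₁ ⊕ₗ ι₂) (ι₁ ⊕ₗ ι₂) 𝕜) (x : ι₁) (y : ι₂) : 𝕜 :=
  contr 𝕜 C (toLex (Sum.inl x)) (toLex (Sum.inr y))

/-- (309) for `n = 1`: `∫ Ψ(x)Ψ̄(x̄) dμ_Γ = Γ(x,x̄)`. [cite: Dimock2002QED3TorusI, App. B (308)–(309) p.63 L35–45] -/
theorem gaussExpect_gen_mul_gen (C : Matrix (ι₁ ⊕ₗ ι₂) (ι₁ ⊕ₗ ι₂) 𝕜) (x : ι₁) (y : ι₂) :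
    gaussExpect 𝕜 C (gen 𝕜 (toLex (Sum.inl x) : ι₁ ⊕ₗ ι₂) * gen 𝕜 (toLex (Sum.inr y))) = twoPoint C x y := by
  have h := gaussExpect_genPairProd 𝕜 C (fun _ : Fin 1 => (toLex (Sum.inl x) : ι₁ ⊕ₗ ι₂))
    (fun _ => toLex (Sum.inr y)) (fun i j => by rw [contr_apply, sub_self, mul_zero])
  rw [genPairProd_succ, genPairProd_zero, mul_one, Matrix.det_unique, Matrix.of_apply] at h
  exact h

/-- The interleaved product `Ψ(x₁)Ψ̄(x̄₁)⋯Ψ(x_n)Ψ̄(x̄_n)` of (309) (the tree's `genPairProd`). [cite: Dimock2002QED3TorusI, App. B (308)–(309) p.63 L35–45] -/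
def pairedProd {n : ℕ} (x : Fin n → ι₁) (y : Fin n → ι₂) : GrassmannAlgebra 𝕜 (ι₁ ⊕ₗ ι₂) :=
  genPairProd 𝕜 (fun i => (toLex (Sum.inl (x i)) : ι₁ ⊕ₗ ι₂)) (fun i => toLex (Sum.inr (y i)))

omit [LinearOrder ι₁] [Fintype ι₁] [LinearOrder ι₂] [Fintype ι₂] in
/-- No `Ψ–Ψ` contraction: `∫ Ψ(a)Ψ(b) dμ_Γ = 0`. [cite: Dimock2002QED3TorusI, App. B (308)–(309) p.63 L35–45] -/
theorem contr_inl_inl_of_isChargedCov {C : Matrix (ι₁ ⊕ₗ ι₂) (ι₁ ⊕ₗ ι₂) 𝕜} (hC : IsChargedCov C) (a b : ι₁) :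
    contr 𝕜 C (toLex (Sum.inl a)) (toLex (Sum.inl b)) = 0 := by
  rw [contr_apply, hC _ _ (by simp), hC _ _ (by simp), sub_zero, mul_zero]

/-- **(309)**: `∫ Ψ(x₁)Ψ̄(x̄₁)⋯Ψ(x_n)Ψ̄(x̄_n) dμ_Γ(Ψ,Ψ̄) = det{Γ(x_i,x̄_j)}` — the tree's determinant rule `gaussExpect_genPairProd`
(Feldman–Knörrer–Trubowitz, the paper's [17]) on the two-species algebra. [cite: Dimock2002QED3TorusI, App. B (308)–(309) p.63 L35–45] -/
theorem gaussExpect_pairedProd {C : Matrix (ι₁ ⊕ₗ ι₂) (ι₁ ⊕ₗ ι₂) 𝕜} (hC : IsChargedCov C) {n : ℕ}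
    (x : Fin n → ι₁) (y : Fin n → ι₂) :
    gaussExpect 𝕜 C (pairedProd x y) = (Matrix.of fun i j => twoPoint C (x i) (y j)).det :=
  gaussExpect_genPairProd 𝕜 C _ _ fun i j => contr_inl_inl_of_isChargedCov hC (x i) (x j)

omit [LinearOrder ι₁] [Fintype ι₁] [LinearOrder ι₂] [Fintype ι₂] in
/-- `Ψ(x₁)⋯Ψ(x_n)Ψ̄(x̄₁)⋯Ψ̄(x̄_m)` has `m` letters `Ψ̄` and `n` letters `Ψ`. [cite: Dimock2002QED3TorusI, App. B p.63 L41 («Terms with n ≠ m give zero»)] -/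
theorem card_filter_species_pairTuple {n m : ℕ} (x : Fin n → ι₁) (y : Fin m → ι₂) :
    (univ.filter fun i => species (pairTuple x y i) = true).card = m ∧
      (univ.filter fun i => ¬species (pairTuple x y i) = true).card = n := by
  constructor
  · rw [Finset.card_filter, Fin.sum_univ_add]
    simp [pairTuple_castAdd, pairTuple_natAdd]
  · rw [Finset.card_filter, Fin.sum_univ_add]
    simp [pairTuple_castAdd, pairTuple_natAdd]

/-- **"Terms with `n ≠ m` give zero"**: `∫ Ψ(x₁)⋯Ψ(x_n)Ψ̄(x̄₁)⋯Ψ̄(x̄_m) dμ_Γ = 0` for `n ≠ m` (the tree's `U(1)` selection rule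
`gaussExpect_genProd_eq_zero_of_charge`). [cite: Dimock2002QED3TorusI, App. B p.63 L41 («Terms with n ≠ m give zero»)] -/
theorem gaussExpect_genProd_pairTuple_eq_zero {C : Matrix (ι₁ ⊕ₗ ι₂) (ι₁ ⊕ₗ ι₂) 𝕜} (hC : IsChargedCov C)
    {n m : ℕ} (hnm : n ≠ m) (x : Fin n → ι₁) (y : Fin m → ι₂) :
    gaussExpect 𝕜 C (genProd 𝕜 (pairTuple x y)) = 0 := by
  classical
  refine gaussExpect_genProd_eq_zero_of_charge 𝕜 species C hC (pairTuple x y) ?_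
  obtain ⟨h1, h2⟩ := card_filter_species_pairTuple x y
  rw [h1, h2]
  exact fun h => hnm h.symm

/-- The terms with `n = m` in block order: `∫ Ψ(x₁)⋯Ψ(x_n)Ψ̄(x̄₁)⋯Ψ̄(x̄_n) dμ_Γ = σ_n det{Γ(x_i,x̄_j)}` with `σ_n = (−1)^{n(n−1)/2}`
— *"Let `σ_n` be the sign of the permutation that takes `Ψ(x₁)⋯Ψ(x_n)Ψ̄(x̄₁)⋯Ψ̄(x̄_n)` to `Ψ(x₁)Ψ̄(x̄₁)⋯Ψ(x_n)Ψ̄(x̄_n)`"*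
(p.64 L7–8), here explicit (the tree's block determinant rule `gaussExpect_genProd_mul_genProd`). [cite: Dimock2002QED3TorusI, App. B (312) p.64 L7–18] -/
theorem gaussExpect_genProd_pairTuple_eq_det {C : Matrix (ι₁ ⊕ₗ ι₂) (ι₁ ⊕ₗ ι₂) 𝕜} (hC : IsChargedCov C) {n : ℕ}
    (x : Fin n → ι₁) (y : Fin n → ι₂) :
    gaussExpect 𝕜 C (genProd 𝕜 (pairTuple x y)) =
      (-1 : 𝕜) ^ (n.choose 2) * (Matrix.of fun i j => twoPoint C (x i) (y j)).det := by
  rw [pairTuple_eq_append, genProd_append]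
  exact gaussExpect_genProd_mul_genProd 𝕜 C _ _ fun i j => contr_inl_inl_of_isChargedCov hC (x i) (x j)

/-- **(312)**: `∫ F dμ_Γ = Σ_n (σ_n/(n!)²) Σ_{x₁…x_n, x̄₁…x̄_n} f_{n,n}(x₁,…,x_n,x̄₁,…,x̄_n) det{Γ(x_i,x̄_j)}`, `σ_n = (−1)^{n(n−1)/2}`, the sum
running over `n ≤ min(|ι₁|,|ι₂|)` — from (305): the `(n,m)` terms with `n ≠ m` integrate to zero, the diagonal ones by (309).
[cite: Dimock2002QED3TorusI, App. B (312) p.64 L7–18] -/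
theorem gaussExpect_eq_312 {C : Matrix (ι₁ ⊕ₗ ι₂) (ι₁ ⊕ₗ ι₂) 𝕜} (hC : IsChargedCov C)
    (F : GrassmannAlgebra 𝕜 (ι₁ ⊕ₗ ι₂)) :
    gaussExpect 𝕜 C F = ∑ n ∈ range (min (Fintype.card ι₁) (Fintype.card ι₂) + 1),
      ((-1 : 𝕜) ^ (n.choose 2) * ((n.factorial : 𝕜)⁻¹ * ((n.factorial : 𝕜)⁻¹))) *
        ∑ x : Fin n → ι₁, ∑ y : Fin n → ι₂, kernel₂ F n n x y * (Matrix.of fun i j => twoPoint C (x i) (y j)).det := by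
  classical
  -- the Gaussian integral of the (n,m) term of (305)
  set S : ℕ → ℕ → 𝕜 := fun n m =>
    ∑ x : Fin n → ι₁, ∑ y : Fin m → ι₂, kernel₂ F n m x y * gaussExpect 𝕜 C (genProd 𝕜 (pairTuple x y)) with hS
  have hF : gaussExpect 𝕜 C F = ∑ n ∈ range (Fintype.card ι₁ + 1), ∑ m ∈ range (Fintype.card ι₂ + 1),
      ((n.factorial : 𝕜)⁻¹ * ((m.factorial : 𝕜)⁻¹)) * S n m := by
    conv_lhs => rw [expansion_305 F]
    simp only [map_sum, map_smul, smul_eq_mul, hS, Finset.mul_sum]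
  -- "Terms with n ≠ m give zero"
  have hoff : ∀ n m : ℕ, n ≠ m → S n m = 0 := by
    intro n m hnm
    exact Finset.sum_eq_zero fun x _ => Finset.sum_eq_zero fun y _ => by
      rw [gaussExpect_genProd_pairTuple_eq_zero hC hnm, mul_zero]
  have hdiag : ∀ n ∈ range (Fintype.card ι₁ + 1),
      ∑ m ∈ range (Fintype.card ι₂ + 1), ((n.factorial : 𝕜)⁻¹ * ((m.factorial : 𝕜)⁻¹)) * S n m =
        if n ∈ range (Fintype.card ι₂ + 1) then ((n.factorial : 𝕜)⁻¹ * ((n.factorial : 𝕜)⁻¹)) * S n n else 0 := by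
    intro n _
    split_ifs with h
    · exact Finset.sum_eq_single_of_mem n h fun m _ hmn => by rw [hoff n m (Ne.symm hmn), mul_zero]
    · exact Finset.sum_eq_zero fun m hm => by rw [hoff n m (fun e => h (e ▸ hm)), mul_zero]
  rw [hF, Finset.sum_congr rfl hdiag, ← Finset.sum_filter]
  have hrange : (range (Fintype.card ι₁ + 1)).filter (fun n => n ∈ range (Fintype.card ι₂ + 1)) =
      range (min (Fintype.card ι₁) (Fintype.card ι₂) + 1) := by
    ext n
    simp only [mem_filter, mem_range, Nat.lt_succ_iff, le_min_iff]
  rw [hrange]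
  refine Finset.sum_congr rfl fun n _ => ?_
  -- "terms with n = m are integrated by (309)" (block form, sign σ_n)
  rw [hS]
  simp only [gaussExpect_genProd_pairTuple_eq_det hC, Finset.mul_sum]
  refine Finset.sum_congr rfl fun x _ => Finset.sum_congr rfl fun y _ => ?_
  ring

end QED3TorusI

end Literature.MathematicalPhysics.QuantumFieldTheory.Dimock2011to13
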